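import Summits.Ventures.QEC.Census.LRATBridge
import HarnessLib

/-!
# Kernel-B distance certificates, K2 half: pinned / cubed (`enc-v2`) leaf certificates

Cell `qec`, PARTITION v2 row type-11.  A kernel-B certificate of scheme `sym` (qec-search-2
`kb/cubes.py`) proves emptiness of `T_w = {v : H v = 0, v ∉ rs H_other, wt v ≤ w}` by CASES (lists of
coordinate literals, e.g. for a two-block code `[x₀]` and `[¬x₀,…,¬x_{ℓm-1}, x_{ℓm}]`, justified by a
symmetry lemma — type-12's orbit reduction, entering here as the hypothesis `hsym`) and, inside each
case, a COMPLETE family of cubes (coordinate literals; completeness structural or by the UNSAT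
`coverCNF`, `cover_of_unsat`), every leaf `leafCNF = base ++ units(case ++ cube)` being refuted (LRAT,
replayed natively or in the kernel).  `hammingNorm_gt_of_leaves` assembles these into the weight lower
bound and `le_dX_of_leaves` / `le_dZ_of_leaves` into `d ≤ d^X / d^Z` via `CSSCode.le_dX`.
-/

namespace Summit.Ventures.QEC.Census.LRATBridge

open Std.Sat Std.Tactic.BVDecide Summit.Ventures.QEC.Census.CNFEncode
open Literature.InformationTheory.QuantumCodes Matrix

/-- The clause LIST of `cnfEncodeAny` (so that certificate modules reduce lists, never `Array`, in
the kernel: `cnfEncodeAny_eq_mk`, `leafCNF_eq_mk`). -/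
def cnfEncodeAnyClauses (n : ℕ) (rows : List (List ℕ)) (us : List (List ℕ)) (w : ℕ) : List Clause :=
  let r1 := encRows n rows
  let r2 := encLogicals r1.2 us
  r1.1 ++ r2.1 ++ [r2.2.2.map fun t => (t, true)] ++ atMost n w r2.2.1

/-- `cnfEncodeAny` is the array of `cnfEncodeAnyClauses`. -/
theorem cnfEncodeAny_eq_mk (n : ℕ) (rows us : List (List ℕ)) (w : ℕ) :
    cnfEncodeAny n rows us w = ⟨(cnfEncodeAnyClauses n rows us w).toArray⟩ := rfl

/-- `a` satisfies every literal of the list (literal `(x, b)`: `a x = b`). -/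
def SatLits (a : ℕ → Bool) (ls : List (Literal ℕ)) : Prop := ∀ l ∈ ls, a l.1 = l.2

/-- The unit clauses of a list of literals (what an `enc-v2` leaf appends to the base CNF). -/
def units (ls : List (Literal ℕ)) : List Clause := ls.map fun l => [l]

/-- The leaf CNF of case literals `cs` and cube literals `qs`: base `Q_any` CNF `++` their unit clauses
(in this order — the clause order of search-2's leaves). -/
def leafCNF (n : ℕ) (rows us : List (List ℕ)) (w : ℕ) (cs qs : List (Literal ℕ)) : CNF Nat :=
  cnfEncodeAny n rows us w ++ (⟨(units (cs ++ qs)).toArray⟩ : CNF Nat)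

/-- A leaf CNF as ONE clause list (the shape kernel-replay modules state). -/
theorem leafCNF_eq_mk (n : ℕ) (rows us : List (List ℕ)) (w : ℕ) (cs qs : List (Literal ℕ)) :
    leafCNF n rows us w cs qs = ⟨(cnfEncodeAnyClauses n rows us w ++ units (cs ++ qs)).toArray⟩ := by
  simp only [leafCNF, cnfEncodeAny_eq_mk]
  show CNF.append _ _ = _
  simp [CNF.append]

/-- The completeness CNF of a cube family below the pin `o`: `[x_o]` and, per cube, the clause negating
its literals. -/
def coverCNF (o : ℕ) (cubes : List (List (Literal ℕ))) : CNF Nat :=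
  ⟨([(o, true)] :: cubes.map fun q => q.map fun l => (l.1, !l.2)).toArray⟩

/-- Unit clauses of satisfied literals are satisfied. -/
theorem units_eval (a : ℕ → Bool) (ls : List (Literal ℕ)) (h : SatLits a ls) :
    ∀ c ∈ units ls, CNF.Clause.eval a c = true := by
  intro c hc
  simp only [units, List.mem_map] at hc
  obtain ⟨l, hl, rfl⟩ := hc
  simp [CNF.Clause.eval, h l hl]

/-- Unit clauses of coordinate literals mention only coordinates. -/
theorem units_vars (ls : List (Literal ℕ)) {n : ℕ} (h : ∀ l ∈ ls, l.1 < n) :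
    ∀ c ∈ units ls, ∀ l ∈ c, l.1 < n := by
  intro c hc l hl
  simp only [units, List.mem_map] at hc
  obtain ⟨l', hl', rfl⟩ := hc
  simp only [List.mem_singleton] at hl
  exact hl ▸ h l' hl'

/-- A clause is false iff all its literals are. -/
theorem clause_eval_false_iff (a : ℕ → Bool) (c : Clause) :
    CNF.Clause.eval a c = false ↔ ∀ l ∈ c, a l.1 ≠ l.2 := by
  induction c with
  | nil => simp
  | cons l c ih =>
    rw [CNF.Clause.eval_cons, Bool.or_eq_false_iff, ih]
    simp

/-- **Coverage from the completeness CNF**: if `coverCNF o cubes` is unsatisfiable, every assignment with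
`x_o` true satisfies all literals of some cube. -/
theorem cover_of_unsat {o : ℕ} {cubes : List (List (Literal ℕ))} (h : (coverCNF o cubes).Unsat)
    (a : ℕ → Bool) (ho : a o = true) : ∃ q ∈ cubes, SatLits a q := by
  have he := h a
  simp only [coverCNF, CNF.eval, List.all_toArray, List.all_cons, Bool.and_eq_false_iff] at he
  rcases he with he | he
  · simp [CNF.Clause.eval, ho] at he
  · rw [List.all_eq_false] at he
    obtain ⟨c, hc, hfalse⟩ := he
    simp only [List.mem_map] at hc
    obtain ⟨q, hq, rfl⟩ := hc
    refine ⟨q, hq, fun l hl => ?_⟩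
    rw [Bool.not_eq_true, clause_eval_false_iff] at hfalse
    have hl' := hfalse (l.1, !l.2) (List.mem_map.2 ⟨l, hl, rfl⟩)
    revert hl'
    cases a l.1 <;> cases l.2 <;> simp

/-- `toAssign` read back as a statement about the vector: `x_i` true iff `v i ≠ 0`. -/
theorem toAssign_eq_iff {n : ℕ} (v : Fin n → ZMod 2) (i : ℕ) (hi : i < n) (b : Bool) :
    toAssign v i = b ↔ (v ⟨i, hi⟩ ≠ 0 ↔ b = true) := by
  simp only [toAssign, hi, ↓reduceDIte]
  cases b <;> simp

/-- **K2 lower bound from a cubed certificate, inside the cases.**  Data: check matrix `H`, the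
other-type row space `R` (only through `hlog`), logicals `L`, bound `w`, literal CNF data `rows`/`us`
(tied to `H`/`L` by `hrows`/`hus`), and `cases : List (case literals × cube family)`.  Hypotheses:
every leaf CNF is UNSAT (`hleaf`, kernel- or native-replayed); every case's cube family is complete
(`hcover`, e.g. by `cover_of_unsat`); all literals are coordinate literals (`hlits`); completeness of the
logical basis (`hlog`).  Conclusion: every `v ∈ ker H ∖ R` WHICH SATISFIES SOME CASE has weight `> w`. -/
theorem hammingNorm_gt_of_leaves_of_case {m n k w : ℕ} (H : Matrix (Fin m) (Fin n) (ZMod 2))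
    (R : Submodule (ZMod 2) (Fin n → ZMod 2)) (L : Fin k → Fin n → ZMod 2)
    (rows us : List (List ℕ)) (hrows : rowSupports H = rows) (hus : supports L = us)
    (cases : List (List (Literal ℕ) × List (List (Literal ℕ))))
    (hleaf : ∀ cq ∈ cases, ∀ q ∈ cq.2, (leafCNF n rows us w cq.1 q).Unsat)
    (hcover : ∀ cq ∈ cases, ∀ a : ℕ → Bool, SatLits a cq.1 → ∃ q ∈ cq.2, SatLits a q)
    (hlits : ∀ cq ∈ cases, (∀ l ∈ cq.1, l.1 < n) ∧ ∀ q ∈ cq.2, ∀ l ∈ q, l.1 < n)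
    (hlog : ∀ v : Fin n → ZMod 2, H *ᵥ v = 0 → v ∉ R → ∃ j, L j ⬝ᵥ v ≠ 0)
    (v : Fin n → ZMod 2) (hv : H *ᵥ v = 0) (hvR : v ∉ R)
    (hcase : ∃ cq ∈ cases, SatLits (toAssign v) cq.1) : w < hammingNorm v := by
  subst hrows hus
  by_contra hle
  obtain ⟨cq, hcq, hsat⟩ := hcase
  obtain ⟨q, hq, hsatq⟩ := hcover cq hcq (toAssign v) hsat
  have hsol := solvesAny_of_vector H L v hv (hlog v hv hvR) (Nat.le_of_not_lt hle)
  have hl : ∀ l ∈ cq.1 ++ q, l.1 < n := by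
    intro l hl
    rcases List.mem_append.1 hl with hl | hl
    · exact (hlits cq hcq).1 l hl
    · exact (hlits cq hcq).2 q hq l hl
  have hs : SatLits (toAssign v) (cq.1 ++ q) := by
    intro l hl
    rcases List.mem_append.1 hl with hl | hl
    · exact hsat l hl
    · exact hsatq l hl
  exact cnfEncodeAny_append_unsat_imp (units (cq.1 ++ q)) (rowSupports_lt H) (supports_lt L)
    (units_vars _ hl) (hleaf cq hcq q hq) (toAssign v) (units_eval _ _ hs) hsol

/-- **K2 lower bound from a pinned/cubed certificate**: as `hammingNorm_gt_of_leaves_of_case`, with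
the case restriction removed by the symmetry reduction `hsym` (if some `v ∈ ker H ∖ R` has weight
`≤ w` then one of them satisfies some case — type-12's orbit lemmas). -/
theorem hammingNorm_gt_of_leaves {m n k w : ℕ} (H : Matrix (Fin m) (Fin n) (ZMod 2))
    (R : Submodule (ZMod 2) (Fin n → ZMod 2)) (L : Fin k → Fin n → ZMod 2)
    (rows us : List (List ℕ)) (hrows : rowSupports H = rows) (hus : supports L = us)
    (cases : List (List (Literal ℕ) × List (List (Literal ℕ))))
    (hleaf : ∀ cq ∈ cases, ∀ q ∈ cq.2, (leafCNF n rows us w cq.1 q).Unsat)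
    (hcover : ∀ cq ∈ cases, ∀ a : ℕ → Bool, SatLits a cq.1 → ∃ q ∈ cq.2, SatLits a q)
    (hlits : ∀ cq ∈ cases, (∀ l ∈ cq.1, l.1 < n) ∧ ∀ q ∈ cq.2, ∀ l ∈ q, l.1 < n)
    (hlog : ∀ v : Fin n → ZMod 2, H *ᵥ v = 0 → v ∉ R → ∃ j, L j ⬝ᵥ v ≠ 0)
    (hsym : (∃ v : Fin n → ZMod 2, H *ᵥ v = 0 ∧ v ∉ R ∧ hammingNorm v ≤ w) →
      ∃ v : Fin n → ZMod 2, H *ᵥ v = 0 ∧ v ∉ R ∧ hammingNorm v ≤ w ∧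
        ∃ cq ∈ cases, SatLits (toAssign v) cq.1)
    (v : Fin n → ZMod 2) (hv : H *ᵥ v = 0) (hvR : v ∉ R) : w < hammingNorm v := by
  by_contra hle
  obtain ⟨v', hv', hv'R, hw', hcase⟩ := hsym ⟨v, hv, hvR, Nat.le_of_not_lt hle⟩
  have := hammingNorm_gt_of_leaves_of_case H R L rows us hrows hus cases hleaf hcover hlits hlog v'
    hv' hv'R hcase
  omega

/-- **`d ≤ d^X` from a pinned/cubed kernel-B certificate** (`H = H^Z`, `R = rs H^X`, `L = LZ`,
`w = d - 1`), via `CSSCode.le_dX`. -/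
theorem le_dX_of_leaves {mX mZ n k : ℕ} (C : CSSCode (Fin mX) (Fin mZ) (Fin n))
    (LZ : Fin k → Fin n → ZMod 2) (d : ℕ) (rows us : List (List ℕ))
    (hrows : rowSupports C.HZ = rows) (hus : supports LZ = us)
    (cases : List (List (Literal ℕ) × List (List (Literal ℕ))))
    (hleaf : ∀ cq ∈ cases, ∀ q ∈ cq.2, (leafCNF n rows us (d - 1) cq.1 q).Unsat)
    (hcover : ∀ cq ∈ cases, ∀ a : ℕ → Bool, SatLits a cq.1 → ∃ q ∈ cq.2, SatLits a q)
    (hlits : ∀ cq ∈ cases, (∀ l ∈ cq.1, l.1 < n) ∧ ∀ q ∈ cq.2, ∀ l ∈ q, l.1 < n)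
    (hlog : ∀ v : Fin n → ZMod 2, C.HZ *ᵥ v = 0 → v ∉ C.rowSpX → ∃ j, LZ j ⬝ᵥ v ≠ 0)
    (hsym : (∃ v : Fin n → ZMod 2, C.HZ *ᵥ v = 0 ∧ v ∉ C.rowSpX ∧ hammingNorm v ≤ d - 1) →
      ∃ v : Fin n → ZMod 2, C.HZ *ᵥ v = 0 ∧ v ∉ C.rowSpX ∧ hammingNorm v ≤ d - 1 ∧
        ∃ cq ∈ cases, SatLits (toAssign v) cq.1)
    (hex : ∃ v : Fin n → ZMod 2, C.HZ *ᵥ v = 0 ∧ v ∉ C.rowSpX) : d ≤ C.dX := by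
  refine C.le_dX hex fun v hv hv' => ?_
  have := hammingNorm_gt_of_leaves C.HZ C.rowSpX LZ rows us hrows hus cases hleaf hcover hlits
    hlog hsym v hv hv'
  omega

/-- `Z` twin of `le_dX_of_leaves` (`H = H^X`, `R = rs H^Z`, `L = LX`). -/
theorem le_dZ_of_leaves {mX mZ n k : ℕ} (C : CSSCode (Fin mX) (Fin mZ) (Fin n))
    (LX : Fin k → Fin n → ZMod 2) (d : ℕ) (rows us : List (List ℕ))
    (hrows : rowSupports C.HX = rows) (hus : supports LX = us)
    (cases : List (List (Literal ℕ) × List (List (Literal ℕ))))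
    (hleaf : ∀ cq ∈ cases, ∀ q ∈ cq.2, (leafCNF n rows us (d - 1) cq.1 q).Unsat)
    (hcover : ∀ cq ∈ cases, ∀ a : ℕ → Bool, SatLits a cq.1 → ∃ q ∈ cq.2, SatLits a q)
    (hlits : ∀ cq ∈ cases, (∀ l ∈ cq.1, l.1 < n) ∧ ∀ q ∈ cq.2, ∀ l ∈ q, l.1 < n)
    (hlog : ∀ v : Fin n → ZMod 2, C.HX *ᵥ v = 0 → v ∉ C.rowSpZ → ∃ j, LX j ⬝ᵥ v ≠ 0)
    (hsym : (∃ v : Fin n → ZMod 2, C.HX *ᵥ v = 0 ∧ v ∉ C.rowSpZ ∧ hammingNorm v ≤ d - 1) →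
      ∃ v : Fin n → ZMod 2, C.HX *ᵥ v = 0 ∧ v ∉ C.rowSpZ ∧ hammingNorm v ≤ d - 1 ∧
        ∃ cq ∈ cases, SatLits (toAssign v) cq.1)
    (hex : ∃ v : Fin n → ZMod 2, C.HX *ᵥ v = 0 ∧ v ∉ C.rowSpZ) : d ≤ C.dZ :=
  le_dX_of_leaves C.swap LX d rows us hrows hus cases hleaf hcover hlits hlog hsym hex

end Summit.Ventures.QEC.Census.LRATBridge
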